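import Literature.AlgebraicGeometry.Resolution.ResidueFieldEmbedding
import Literature.AlgebraicGeometry.Resolution.RankOneDensity
import HarnessLib

/-!
# Lifting a Frobenius-closed basis of the residue field (Kuhlmann 2010, Lemma 4.10, second assertion)

Topic: `Literature/AlgebraicGeometry/Resolution` (valued function fields). Third step of the
proof of F.-V. Kuhlmann, *Elimination of ramification I: The generalized stability theorem*,
Trans. AMS 362 (2010) 5697–5727 = arXiv:1003.5678, **Lemma 4.10** (p. 14 of the arXiv version),
whose second assertion — "The ring `R = K[F̄] ⊂ F` satisfies properties (LFC1), (LFC2) and (LFC3)"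
— is the named fact `Kuhlmann2010Lemma410` of `FrobeniusClosedBases.lean`
(`IsLiftedFrobeniusClosedBasisRing`). Printed proof (p. 14):

> By construction, `K` and `F̄` are linearly disjoint over `K̄`. We form the subring generated by
> both fields in `F`: `R = K[F̄] ⊂ F`. By (4.12), `F` is the henselization of the quotient field
> of `R`. Since the rank of `F` is 1, the field Quot(`R`) is dense in its henselization by
> Lemma 2.4, hence `R` satisfies property (LFC1). Every `K̄`-basis of `F̄` is at the same time a
> `K`-basis of `R`. As the residue map induces the identity on `F̄`, every such basis is a
> valuation basis of `R` over `K`. Thus, `R` satisfies (LFC2). If we choose, as indicated above,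
> a Frobenius-closed basis of `F̄|K̄` then `R` together with this basis also satisfies property
> (LFC3).

This file PROVES that assertion GIVEN a Frobenius-closed `K̄`-basis of `F̄` containing `1`
("as indicated above": [K5] = Kuhlmann 2006, Thm. 10, whose linear-algebra half is
`Literature.FieldTheory.FunctionField.exists_frobeniusClosed_basis_of_filtration`): with the
section `ι : F̄ → F` of `ResidueFieldEmbedding.lean`, `B = ι(basis)` and `R` = the `K`-span of
`B` (a subring, `= K[ι(F̄)]`), the eleven clauses of `IsLiftedFrobeniusClosedBasisRing V p K F R B`
hold: valuation independence because the residues of `B` are the given `K̄`-linearly independent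
family and the coefficients, divided by the largest one, reduce to a non-trivial relation
otherwise; density (LFC1) because `F ≤ (K.ι(F̄))^h` (`exists_residueField_section`) with
`K.ι(F̄) ⊆ Quot(R)` of rank one (Lemma 2.4: `exists_mem_valuation_sub_lt_of_isRankOneValued`,
`RankOneDensity.lean`) and `vF = vK`.

## Content (everything PROVED)

* `resid_linearCombination_of_mem`, `exists_valuation_linearCombination_eq` — residues of
  `K`-linear combinations of units and **valuation independence from residual linear
  independence** ("every such basis is a valuation basis of `R` over `K`").
* `spanSubring` — the `K`-span of a multiplicatively stable set containing `1` as a subring.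
* `exists_isLiftedFrobeniusClosedBasisRing` — **Lemma 4.10, second assertion, from a
  Frobenius-closed basis of `F̄|K̄`**.

## Sources

* F.-V. Kuhlmann, Trans. AMS 362 (2010) = arXiv:1003.5678, §2.4, §4.2 Lemma 4.7 ((LFC1)–(LFC3)),
  Lemma 4.10 and its proof (p. 14), Lemma 2.4.
* F.-V. Kuhlmann, Lect. Notes Log. 26 (2006) = arXiv:1003.5683, Thm. 10 ([K5]).
-/

noncomputable section

open IsLocalRing

namespace Literature.AlgebraicGeometry.Resolution

universe u

variable {Ω : Type u} [Field Ω] (V : ValuationSubring Ω)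

/-! ### Valuation independence from residual linear independence -/

section ValuationIndependence

variable {K : Subfield Ω} {B : Set Ω}

/-- A `K`-linear combination of elements of `V` with coefficients in `V` lies in `V`, and its
residue is the corresponding combination of residues. [folklore] -/
theorem resid_linearCombination_of_mem (hBV : ∀ u ∈ B, u ∈ V) (f : B →₀ K)
    (hf : ∀ u, (f u : Ω) ∈ V) :
    Finsupp.linearCombination K ((↑) : B → Ω) f ∈ V ∧
      resid V (Finsupp.linearCombination K ((↑) : B → Ω) f) =
        ∑ u ∈ f.support, resid V (f u : Ω) * resid V (u : Ω) := by
  rw [IsLiftedFrobeniusClosedBasisRing.linearCombination_eq_sum f]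
  refine ⟨sum_mem fun u _ => mul_mem (hf u) (hBV u u.2), ?_⟩
  rw [resid_sum V _ _ fun u _ => mul_mem (hf u) (hBV u u.2)]
  refine Finset.sum_congr rfl fun u _ => ?_
  rw [resid_mul V (hf u) (hBV u u.2)]

/-- **Valuation independence from residual linear independence** (Kuhlmann 2010, proof of
Lemma 4.10: "As the residue map induces the identity on `F̄`, every such basis is a valuation
basis of `R` over `K`"; §2.4: "`v ∑ cᵢbᵢ = min vcᵢbᵢ`"): if `B ⊆ Ω` consists of elements of value
`1` whose residues are `K̄`-linearly independent, then the value of a non-zero `K`-linear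
combination of `B` is the value of its largest coefficient. PROVED (divide by the largest
coefficient; the residue of the result is a non-trivial `K̄`-combination of the residues).
[cite: Kuhlmann2010, Lemma 4.10 (proof, p. 14) and Section 2.4] -/
theorem exists_valuation_linearCombination_eq (hB1 : ∀ u ∈ B, V.valuation u = 1)
    (hli : LinearIndependent (residueSubfield K V) (fun u : B => resid V (u : Ω)))
    (f : B →₀ K) (hf : f ≠ 0) :
    ∃ u₀ ∈ f.support,
      V.valuation (Finsupp.linearCombination K ((↑) : B → Ω) f) = V.valuation (f u₀ : Ω) ∧
      ∀ w ∈ f.support, V.valuation (f w : Ω) ≤ V.valuation (f u₀ : Ω) := by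
  classical
  have hBV : ∀ u ∈ B, u ∈ V := fun u hu => (V.valuation_le_one_iff u).mp (hB1 u hu).le
  obtain ⟨u₀, hu₀, hmax⟩ := Finset.exists_max_image f.support (fun w => V.valuation (f w : Ω))
    (Finsupp.support_nonempty_iff.mpr hf)
  refine ⟨u₀, hu₀, le_antisymm ?_ ?_, hmax⟩
  · -- ultrametric inequality
    rw [IsLiftedFrobeniusClosedBasisRing.linearCombination_eq_sum f]
    refine V.valuation.map_sum_le fun w hw => ?_
    rw [map_mul, hB1 w w.2, mul_one]
    exact hmax w hw
  · -- divide by the largest coefficient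
    set c₀ : K := f u₀ with hc₀
    have hc₀0 : c₀ ≠ 0 := Finsupp.mem_support_iff.mp hu₀
    have hc₀0' : (c₀ : Ω) ≠ 0 := fun h => hc₀0 (Subtype.ext h)
    have hvc₀ : 0 < V.valuation (c₀ : Ω) := (Valuation.pos_iff _).mpr hc₀0'
    set f' : B →₀ K := c₀⁻¹ • f with hf'
    have hf'u : ∀ u, (f' u : Ω) = ((c₀ : Ω))⁻¹ * (f u : Ω) := fun u => by
      rw [hf', Finsupp.smul_apply, smul_eq_mul]
      rfl
    have hf'val : ∀ u, V.valuation (f' u : Ω) ≤ 1 := by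
      intro u
      rw [hf'u, map_mul, map_inv₀]
      by_cases hu : u ∈ f.support
      · rw [inv_mul_le_one₀ hvc₀]
        exact hmax u hu
      · rw [Finsupp.notMem_support_iff.mp hu]
        simp
    have hf'V : ∀ u, (f' u : Ω) ∈ V := fun u => (V.valuation_le_one_iff _).mp (hf'val u)
    have hf'u₀ : (f' u₀ : Ω) = 1 := by rw [hf'u, ← hc₀, inv_mul_cancel₀ hc₀0']
    have hlc : Finsupp.linearCombination K ((↑) : B → Ω) f' =
        ((c₀ : Ω))⁻¹ * Finsupp.linearCombination K ((↑) : B → Ω) f := by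
      rw [hf', map_smul, Algebra.smul_def, map_inv₀]
      rfl
    -- the residue of `lc f'` is a non-trivial combination of the residues
    obtain ⟨hmem, hres⟩ := resid_linearCombination_of_mem V hBV f' hf'V
    set e : B →₀ residueSubfield K V := Finsupp.onFinset f'.support
      (fun u => ⟨resid V (f' u : Ω), resid_mem_residueSubfield V (f' u).2⟩) (by
        intro u hu
        by_contra hnot
        apply hu
        apply Subtype.ext
        change resid V (f' u : Ω) = 0
        rw [Finsupp.notMem_support_iff.mp hnot]
        exact resid_zero V) with he
    have hlce : Finsupp.linearCombination (residueSubfield K V) (fun u : B => resid V (u : Ω)) e =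
        resid V (Finsupp.linearCombination K ((↑) : B → Ω) f') := by
      rw [hres, he, Finsupp.linearCombination_onFinset]
      refine Finset.sum_congr rfl fun u _ => ?_
      rw [Algebra.smul_def]
      rfl
    have he0 : e ≠ 0 := by
      intro h0
      have h1 : e u₀ = 0 := by rw [h0, Finsupp.zero_apply]
      have h2 : ((e u₀ : residueSubfield K V) : ResidueField V) = resid V (f' u₀ : Ω) := rfl
      rw [h1, hf'u₀, resid_one] at h2
      exact zero_ne_one h2
    have hne : resid V (Finsupp.linearCombination K ((↑) : B → Ω) f') ≠ 0 := by
      rw [← hlce]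
      exact fun h0 => he0 (linearIndependent_iff.mp hli e h0)
    have hv1 : V.valuation (Finsupp.linearCombination K ((↑) : B → Ω) f') = 1 :=
      (resid_ne_zero_iff V hmem).mp hne
    rw [hlc, map_mul, map_inv₀, inv_mul_eq_one₀ hvc₀.ne'] at hv1
    exact hv1.le

end ValuationIndependence

/-! ### The `K`-span of a set as a subring -/

section SpanSubring

variable {K : Subfield Ω} {B : Set Ω}

omit V in
/-- **The `K`-span of `B` is a subring** when `1 ∈ B` and products of elements of `B` lie in the
span (Kuhlmann 2010, proof of Lemma 4.10: "We form the subring generated by both fields in `F`: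
`R = K[F̄]` … Every `K̄`-basis of `F̄` is at the same time a `K`-basis of `R`"). [cite: Kuhlmann2010, Lemma 4.10 (proof, p. 14)] -/
def spanSubring (K : Subfield Ω) (B : Set Ω) (h1 : (1 : Ω) ∈ B)
    (hmul : ∀ u ∈ B, ∀ u' ∈ B, u * u' ∈ Submodule.span K B) : Subring Ω where
  carrier := Submodule.span K B
  mul_mem' {r s} hr hs := by
    change r * s ∈ Submodule.span K B
    change r ∈ Submodule.span K B at hr
    change s ∈ Submodule.span K B at hs
    -- first for `r ∈ B`
    have key : ∀ u ∈ B, ∀ s ∈ Submodule.span K B, u * s ∈ Submodule.span K B := by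
      intro u hu s hs
      induction hs using Submodule.span_induction with
      | mem s hs => exact hmul u hu s hs
      | zero => rw [mul_zero]; exact Submodule.zero_mem _
      | add s t _ _ ihs iht => rw [mul_add]; exact Submodule.add_mem _ ihs iht
      | smul c s _ ihs => rw [mul_smul_comm]; exact Submodule.smul_mem _ c ihs
    induction hr using Submodule.span_induction with
    | mem r hr => exact key r hr s hs
    | zero => rw [zero_mul]; exact Submodule.zero_mem _
    | add r t _ _ ihr iht => rw [add_mul]; exact Submodule.add_mem _ ihr iht
    | smul c r _ ihr => rw [smul_mul_assoc]; exact Submodule.smul_mem _ c ihr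
  one_mem' := Submodule.subset_span h1
  add_mem' {r s} hr hs := Submodule.add_mem _ hr hs
  zero_mem' := Submodule.zero_mem _
  neg_mem' {r} hr := Submodule.neg_mem _ hr

omit V in
/-- Membership in `spanSubring`. [folklore] -/
theorem mem_spanSubring_iff {h1 : (1 : Ω) ∈ B}
    {hmul : ∀ u ∈ B, ∀ u' ∈ B, u * u' ∈ Submodule.span K B} (r : Ω) :
    r ∈ spanSubring K B h1 hmul ↔ r ∈ Submodule.span K B := Iff.rfl

end SpanSubring

/-! ### Lemma 4.10, second assertion, from a Frobenius-closed basis of `F̄|K̄` -/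

section Lift

/-- **Kuhlmann 2010, Lemma 4.10 (second assertion) from a Frobenius-closed basis of the residue
field**: "The ring `R = K[F̄] ⊂ F` satisfies properties (LFC1), (LFC2) and (LFC3)" — for `(Ω, V)`
algebraically closed of characteristic `p`, `K ≤ Ω` an algebraically closed subfield and `F` in
the class `IsHenselizedInertiallyGeneratedRT V K`, GIVEN a `K̄`-linearly independent family `b`
in `F̄` spanning `F̄` over `K̄`, containing `1` and closed under `p`-th powers ([K5] Thm. 10),
there are `R` and `𝓑` with `IsLiftedFrobeniusClosedBasisRing V p K F R 𝓑`: `𝓑 = ι(b)` for the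
section `ι : F̄ → F ∩ V` of `exists_residueField_section` and `R` its `K`-span (`= K[ι(F̄)]`).
(LFC2): the residues of `𝓑` are the `b`'s, so `𝓑` is valuation independent
(`exists_valuation_linearCombination_eq`); (LFC3): `ι(bᵢ)^p = ι(bᵢ^p) ∈ 𝓑`; (LFC1): every
`a ∈ F ≤ (K.ι(F̄))^h` is approximated within any `vε`, `ε ∈ F^×` (`vF = vK`), by elements of the
rank-one field `K.ι(F̄) ⊆ Quot(R)` (Lemma 2.4, `exists_mem_valuation_sub_lt_of_isRankOneValued`).
PROVED. [cite: Kuhlmann2010, Lemma 4.10 (with Lemma 4.7 and Lemma 2.4)] -/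
theorem exists_isLiftedFrobeniusClosedBasisRing [IsAlgClosed Ω] (p : ℕ) [Fact p.Prime] [CharP Ω p]
    {K F : Subfield Ω} (hK : IsAlgClosed K) (hF : IsHenselizedInertiallyGeneratedRT V K F)
    {ι' : Type*} (b : ι' → ResidueField V) (hbF : ∀ i, b i ∈ residueSubfield F V) (i₁ : ι')
    (hb1 : b i₁ = 1) (hbp : ∀ i, ∃ j, b j = b i ^ p)
    (hli : LinearIndependent (residueSubfield K V) b)
    (hsp : ∀ r ∈ residueSubfield F V, r ∈ Submodule.span (residueSubfield K V) (Set.range b)) :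
    ∃ (R : Subring Ω) (B : Set Ω), IsLiftedFrobeniusClosedBasisRing V p K F R B := by
  classical
  obtain ⟨ι, hιF, hιV, hιres, hιK, hFh⟩ := exists_residueField_section V p hK hF
  have hKF : K ≤ F := hF.base_le
  -- the lifted family and its range `𝓑`
  set g : ι' → Ω := fun i => ι ⟨b i, hbF i⟩ with hg
  have hg_res : ∀ i, resid V (g i) = b i := fun i => hιres _
  have hg_inj : Function.Injective g := fun i j hij => by
    have h1 : b i = b j := by rw [← hg_res i, ← hg_res j]; exact congrArg (resid V) hij
    exact hli.injective h1
  set B : Set Ω := Set.range g with hB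
  have hBF : ∀ u ∈ B, u ∈ F := by
    rintro _ ⟨i, rfl⟩
    exact hιF _
  have hBV : ∀ u ∈ B, u ∈ V := by
    rintro _ ⟨i, rfl⟩
    exact hιV _
  have hB1 : ∀ u ∈ B, V.valuation u = 1 := by
    rintro _ ⟨i, rfl⟩
    rw [← resid_ne_zero_iff V (hιV _), hg_res]
    exact hli.ne_zero i
  have h1B : (1 : Ω) ∈ B := ⟨i₁, by
    change ι ⟨b i₁, hbF i₁⟩ = 1
    rw [show (⟨b i₁, hbF i₁⟩ : residueSubfield F V) = 1 from Subtype.ext hb1, map_one]⟩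
  -- the residues of `𝓑` are the `b`'s
  have hres_range : Set.range (fun u : B => resid V (u : Ω)) = Set.range b := by
    ext r
    constructor
    · rintro ⟨⟨_, i, rfl⟩, rfl⟩
      exact ⟨i, (hg_res i).symm⟩
    · rintro ⟨i, rfl⟩
      exact ⟨⟨g i, i, rfl⟩, hg_res i⟩
  have hli' : LinearIndependent (residueSubfield K V) (fun u : B => resid V (u : Ω)) := by
    have h1 := hli.comp _ (Equiv.ofInjective g hg_inj).symm.injective
    convert h1 using 1
    ext u
    obtain ⟨_, i, rfl⟩ := u
    rw [Function.comp_apply, Equiv.ofInjective_symm_apply, hg_res]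
  -- `ι` maps `F̄ = span_{K̄} b` into the `K`-span of `𝓑`
  have hspan : ∀ v ∈ Submodule.span (residueSubfield K V) (Set.range b),
      ∃ hv : v ∈ residueSubfield F V, ι ⟨v, hv⟩ ∈ Submodule.span K B := by
    intro v hv
    induction hv using Submodule.span_induction with
    | mem v hv =>
      obtain ⟨i, rfl⟩ := hv
      exact ⟨hbF i, Submodule.subset_span ⟨i, rfl⟩⟩
    | zero =>
      refine ⟨Subfield.zero_mem _, ?_⟩
      rw [show (⟨0, Subfield.zero_mem _⟩ : residueSubfield F V) = 0 from rfl, map_zero]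
      exact Submodule.zero_mem _
    | add v w _ _ ihv ihw =>
      obtain ⟨hv, hv'⟩ := ihv
      obtain ⟨hw, hw'⟩ := ihw
      refine ⟨Subfield.add_mem _ hv hw, ?_⟩
      rw [show (⟨v + w, Subfield.add_mem _ hv hw⟩ : residueSubfield F V) = ⟨v, hv⟩ + ⟨w, hw⟩ from rfl,
        map_add]
      exact Submodule.add_mem _ hv' hw'
    | smul c v _ ihv =>
      obtain ⟨hv, hv'⟩ := ihv
      have hcF : ((c : residueSubfield K V) : ResidueField V) ∈ residueSubfield F V :=
        residueSubfield_subfield_mono hKF c.2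
      have hcv : c • v ∈ residueSubfield F V := by
        rw [Algebra.smul_def]
        exact Subfield.mul_mem _ hcF hv
      refine ⟨hcv, ?_⟩
      have hιc : ι ⟨c, hcF⟩ ∈ K := hιK _ c.2
      rw [show (⟨c • v, hcv⟩ : residueSubfield F V) = ⟨c, hcF⟩ * ⟨v, hv⟩ from
        Subtype.ext (Algebra.smul_def c v), map_mul,
        show ι ⟨c, hcF⟩ * ι ⟨v, hv⟩ = (⟨ι ⟨c, hcF⟩, hιc⟩ : K) • ι ⟨v, hv⟩ from rfl]
      exact Submodule.smul_mem _ _ hv'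
  have hιspan : ∀ w : residueSubfield F V, ι w ∈ Submodule.span K B := fun w => by
    obtain ⟨hw, h⟩ := hspan w.1 (hsp w.1 w.2)
    exact h
  -- the ring `R = K[ι(F̄)]`, the `K`-span of `𝓑`
  have hmulB : ∀ u ∈ B, ∀ u' ∈ B, u * u' ∈ Submodule.span K B := by
    rintro _ ⟨i, rfl⟩ _ ⟨j, rfl⟩
    change ι ⟨b i, hbF i⟩ * ι ⟨b j, hbF j⟩ ∈ _
    rw [← map_mul]
    exact hιspan _
  set R : Subring Ω := spanSubring K B h1B hmulB with hR
  have hKR : ∀ c ∈ K, c ∈ R := fun c hc => by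
    rw [mem_spanSubring_iff]
    have h1 : c = (⟨c, hc⟩ : K) • (1 : Ω) := by rw [Algebra.smul_def, mul_one]; rfl
    rw [h1]
    exact Submodule.smul_mem _ _ (Submodule.subset_span h1B)
  have hRF : ∀ r ∈ R, r ∈ F := fun r hr => by
    rw [mem_spanSubring_iff] at hr
    induction hr using Submodule.span_induction with
    | mem r hr => exact hBF r hr
    | zero => exact F.zero_mem
    | add r s _ _ ihr ihs => exact F.add_mem ihr ihs
    | smul c r _ ihr =>
      rw [Algebra.smul_def]
      exact F.mul_mem (hKF c.2) ihr
  -- (LFC1): density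
  set L₀ : Subfield Ω := Subfield.closure ((K : Set Ω) ∪ Set.range ι) with hL₀
  have hKL₀ : K ≤ L₀ := fun c hc => Subfield.subset_closure (Or.inl hc)
  have hL₀R : L₀ ≤ Subfield.closure (R : Set Ω) := Subfield.closure_le.mpr (Set.union_subset
    (fun c hc => Subfield.subset_closure (hKR c hc)) (by
      rintro _ ⟨w, rfl⟩
      exact Subfield.subset_closure ((mem_spanSubring_iff _).mpr (hιspan w))))
  have hL₀F : L₀ ≤ F := Subfield.closure_le.mpr (Set.union_subset hKF (by
    rintro _ ⟨w, rfl⟩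
    exact hιF w))
  have hrF : IsRankOneValued V F :=
    hF.isRankOneValued_of_algebraic le_rfl fun a ha => isAlgebraic_algebraMap (⟨a, ha⟩ : F)
  obtain ⟨a₀, ha₀K, ha₀⟩ := hF.exists_one_lt_valuation
  have hrL₀ : IsRankOneValued V L₀ := hrF.of_le hL₀F ⟨a₀, hKL₀ ha₀K, ha₀⟩
  have hvF : valueSubgroup F V = valueSubgroup K V := hF.valueSubgroup_eq
  have hdense : ∀ a ∈ F, ∀ ε ∈ F, ε ≠ 0 →
      ∃ q ∈ Subfield.closure (R : Set Ω), V.valuation (a - q) < V.valuation ε := by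
    intro a ha ε hε hε0
    -- `vε = vc` for some `c ∈ K ⊆ L₀`
    have hvε0 : V.valuation ε ≠ 0 := (Valuation.ne_zero_iff _).mpr hε0
    have hmemγ : Units.mk0 _ hvε0 ∈ valueSubgroup F V :=
      (mem_valueSubgroup_iff F V _).mpr ⟨⟨ε, hε⟩, fun h0 => hε0 (congrArg Subtype.val h0), rfl⟩
    rw [hvF] at hmemγ
    obtain ⟨c, hc0, hc⟩ := (mem_valueSubgroup_iff K V _).mp hmemγ
    rw [Units.val_mk0] at hc
    have hc0' : (c : Ω) ≠ 0 := fun h0 => hc0 (Subtype.ext h0)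
    obtain ⟨y, hyL₀, hy⟩ := exists_mem_valuation_sub_lt_of_isRankOneValued hrL₀ (hFh ha)
      (hKL₀ c.2) hc0'
    refine ⟨y, hL₀R hyL₀, ?_⟩
    rw [hc]
    exact hy
  -- the structure
  refine ⟨R, B, ⟨fun c hc => hKR c hc, fun r hr => hRF r hr, hdense, fun u hu => ?_, h1B, hB1,
    fun r => (mem_spanSubring_iff r).symm, fun f u hu => ?_, hli', fun r hr => ?_, ?_⟩⟩
  · -- `𝓑 ⊆ R`
    exact (mem_spanSubring_iff u).mpr (Submodule.subset_span hu)
  · -- valuation independence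
    have hf0 : f ≠ 0 := by
      rintro rfl
      simp at hu
    obtain ⟨u₀, -, heq, hmax⟩ := exists_valuation_linearCombination_eq V hB1 hli' f hf0
    rw [map_mul, hB1 u u.2, mul_one, heq]
    exact hmax u hu
  · -- the residues span `F̄`
    rw [hres_range]
    exact hsp r hr
  · -- Frobenius-closed
    rintro _ ⟨i, rfl⟩
    obtain ⟨j, hj⟩ := hbp i
    refine ⟨j, ?_⟩
    change ι ⟨b j, hbF j⟩ = (ι ⟨b i, hbF i⟩) ^ p
    rw [← map_pow]
    congr 1
    exact Subtype.ext hj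

end Lift

end Literature.AlgebraicGeometry.Resolution
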